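import Summits.QuantumAdvantage.QuantumAdvantage.Theorems.AnchorDialOrbitInv

/-!
# AnchorDial — part 24 «DatumM» (cell decomp-qadv, seat lens-2, generation 15; supports item 26531 `ExactnessDial.PolyLossOddU3`)

§G of the g15 node «GaugeDial»: the GAUGE-TABLE DATUM.  Window unions `winU r kv`, deviation patterns `patU`, the
window index `JOf`, the table polynomial `hTabU` (value `thirdVal S (wTab …)`), `VU` (sum over patterns, composed
with the orbit map), the table component `TU P A r b j₀ g ε = Σ_{k⃗} Π_j selP(A_j k_j) · VU_{k⃗,g,ε}` with its degree
bound `TU_mem` and its value on uniquely-anchored inputs `TU_apply`, the datum `datM x : (g, ε) ↦ TU … g ε x`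
(CONSTANT-SIZE value type), the class indicator `classM` (`classM_mem`, `classM_apply`) and `card_gauge`.  Namespace `…Theorems.AnchorDial`; imports part 23.  Verbatim from the node file; no `sorry`, no `native_decide`, no instances/notation; lint-clean without the unusedVariables switch.
-/

set_option linter.dupNamespace false

/-! ## §G  The GAUGE-TABLE DATUM: `δ(x) = (g, ε) ↦ Σ_{k⃗} Π_j selP(A_j k_j)(x) · V_{k⃗,g,ε}(x)` (constant-size type) -/

noncomputable section

open scoped Classical

namespace Summit.QuantumAdvantage.QuantumAdvantage.Theorems.AnchorDial

open Finset
open Literature.Computability.QuantumComplexity Literature.Computability.QuantumComplexity.RingHLF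
open Literature.Computability.MetaComplexity Literature.Computability.MetaComplexity.Smolensky
open Summit.QuantumAdvantage.AdviceFreeQNC0
open Summit.QuantumAdvantage.QuantumAdvantage.Theorems.HolonomyDial (gCond selP selP_mem selP_apply indP indP_mem indP_apply)

variable {N : ℕ}

section DatumM

variable {F m : ℕ}

/-- the union of the `m` windows `[k_j, k_j + r]`. -/
def winU (r : ℕ) (kv : Fin m → Fin N) : Finset (Fin N) := univ.biUnion fun j => winQ r (kv j)

/-- AnchorDialDatumM helper `mem_winU` (decomp-qadv land package; see the module docstring). -/
theorem mem_winU {r : ℕ} {kv : Fin m → Fin N} {q : Fin N} :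
    q ∈ winU r kv ↔ ∃ j, (kv j).val ≤ q.val ∧ q.val ≤ (kv j).val + r := by
  simp [winU, winQ]

/-- AnchorDialDatumM helper `card_winU_le` (decomp-qadv land package; see the module docstring). -/
theorem card_winU_le (r : ℕ) (kv : Fin m → Fin N) : (winU r kv).card ≤ m * (r + 1) := by
  unfold winU
  refine card_biUnion_le.trans ?_
  calc ∑ j, (winQ r (kv j)).card ≤ ∑ j : Fin m, (r + 1) := sum_le_sum fun j _ => card_winQ_le r (kv j)
    _ = m * (r + 1) := by rw [sum_const, smul_eq_mul, card_univ, Fintype.card_fin]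

/-- PATTERN INDICATOR over the window union. -/
def patU (P : Fin N → CubeFn (ZMod 3) N) (r : ℕ) (kv : Fin m → Fin N) (S : Finset (Fin N)) : CubeFn (ZMod 3) N :=
  ∏ q ∈ winU r kv, (if q ∈ S then devA P q else 1 - devA P q)

/-- AnchorDialDatumM helper `patU_mem` (decomp-qadv land package; see the module docstring). -/
theorem patU_mem {D : ℕ} {P : Fin N → CubeFn (ZMod 3) N} (hP : ∀ i, P i ∈ lowDeg (ZMod 3) N D) (r : ℕ)
    (kv : Fin m → Fin N) (S : Finset (Fin N)) : patU P r kv S ∈ lowDeg (ZMod 3) N (m * (r + 1) * ((D + D) + 2)) := by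
  unfold patU
  refine lowDeg_mono (Nat.mul_le_mul_right _ (card_winU_le r kv)) (prod_mem_lowDeg _ fun q _ => ?_)
  by_cases hq : q ∈ S
  · rw [if_pos hq]; exact devA_mem hP q
  · rw [if_neg hq]; exact Submodule.sub_mem _ (one_mem_lowDeg _) (devA_mem hP q)

/-- AnchorDialDatumM helper `patU_apply_self` (decomp-qadv land package; see the module docstring). -/
theorem patU_apply_self (P : Fin N → CubeFn (ZMod 3) N) (r : ℕ) (kv : Fin m → Fin N) (y : Fin N → Bool) :
    patU P r kv (dev P y) y = 1 := by
  unfold patU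
  rw [Finset.prod_apply]
  refine Finset.prod_eq_one fun q _ => ?_
  by_cases hqd : q ∈ dev P y
  · rw [if_pos hqd, devA_apply, if_pos hqd]
  · rw [if_neg hqd, Pi.sub_apply, Pi.one_apply, devA_apply, if_neg hqd, sub_zero]

/-- AnchorDialDatumM helper `patU_apply_ne` (decomp-qadv land package; see the module docstring). -/
theorem patU_apply_ne (P : Fin N → CubeFn (ZMod 3) N) (r : ℕ) (kv : Fin m → Fin N) (y : Fin N → Bool)
    (S : Finset (Fin N)) (hS : S ⊆ winU r kv) (hdev : dev P y ⊆ winU r kv) (hne : S ≠ dev P y) :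
    patU P r kv S y = 0 := by
  have hex : ∃ q ∈ winU r kv, ¬ (q ∈ S ↔ q ∈ dev P y) := by
    by_contra h
    push Not at h
    exact hne (Finset.ext fun q =>
      ⟨fun hq => (h q (hS hq)).1 hq, fun hq => (h q (hdev hq)).2 hq⟩)
  obtain ⟨q, hqW, hq⟩ := hex
  unfold patU
  rw [Finset.prod_apply]
  refine Finset.prod_eq_zero hqW ?_
  by_cases hqS : q ∈ S
  · have hqd : q ∉ dev P y := fun h => hq ⟨fun _ => h, fun _ => hqS⟩
    rw [if_pos hqS, devA_apply, if_neg hqd]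
  · have hqd : q ∈ dev P y := by
      by_contra h
      exact hq ⟨fun h' => absurd h' hqS, fun h' => absurd h' h⟩
    rw [if_neg hqS, Pi.sub_apply, Pi.one_apply, devA_apply, if_pos hqd, sub_self]

/-- the canonical window assignment of a position (least-choice: some window containing it, else `j₀`). -/
def JOf (r : ℕ) (kv : Fin m → Fin N) (j₀ : Fin m) (q : Fin N) : Fin m :=
  if h : ∃ j, (kv j).val ≤ q.val ∧ q.val ≤ (kv j).val + r then h.choose else j₀

/-- AnchorDialDatumM helper `JOf_spec` (decomp-qadv land package; see the module docstring). -/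
theorem JOf_spec {r : ℕ} {kv : Fin m → Fin N} (j₀ : Fin m) {q : Fin N}
    (hq : ∃ j, (kv j).val ≤ q.val ∧ q.val ≤ (kv j).val + r) :
    (kv (JOf r kv j₀ q)).val ≤ q.val ∧ q.val ≤ (kv (JOf r kv j₀ q)).val + r := by
  unfold JOf
  rw [dif_pos hq]
  exact hq.choose_spec

/-- anchor values. -/
def kAOf (kv : Fin m → Fin N) : Fin m → ℕ := fun j => (kv j).val

/-- sides: `true` = window right of all flip sites. -/
def sdOf (b : Fin F → ℕ) (kv : Fin m → Fin N) : Fin m → Bool := fun j => decide (∀ i, b i + 1 ≤ (kv j).val)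

/-- the EXCLUDED-VALUE TABLE of pattern `S` for the gauge `g` — a LOCAL function of the window bits. -/
def hTabU (r : ℕ) (kv : Fin m → Fin N) (sd : Fin m → Bool) (j₀ : Fin m) (S : Finset (Fin N))
    (g : Fin m → ZMod 3 × Bool) : CubeFn (ZMod 3) N :=
  fun x => thirdVal S (wTab (kAOf kv) sd (JOf r kv j₀) (fun j t => wval x (kv j).val t) g)

/-- AnchorDialDatumM helper `hTabU_mem` (decomp-qadv land package; see the module docstring). -/
theorem hTabU_mem (r : ℕ) (kv : Fin m → Fin N) (sd : Fin m → Bool) (j₀ : Fin m) (S : Finset (Fin N))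
    (hS : S ⊆ winU r kv) (g : Fin m → ZMod 3 × Bool) : hTabU r kv sd j₀ S g ∈ lowDeg (ZMod 3) N (m * r) := by
  set T := (univ : Finset (Fin m)).biUnion fun j =>
    (univ : Finset (Fin N)).filter fun i => (kv j).val + 1 ≤ i.val ∧ i.val < (kv j).val + r with hT
  have hcard : T.card ≤ m * r := by
    refine card_biUnion_le.trans ?_
    have hj : ∀ j : Fin m, ((univ : Finset (Fin N)).filter fun i => (kv j).val + 1 ≤ i.val ∧ i.val < (kv j).val + r).card ≤ r := by
      intro j
      have hsub : ((univ : Finset (Fin N)).filter fun i => (kv j).val + 1 ≤ i.val ∧ i.val < (kv j).val + r).map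
          Fin.valEmbedding ⊆ Finset.Ico ((kv j).val + 1) ((kv j).val + 1 + r) := by
        intro a ha
        rw [Finset.mem_map] at ha
        obtain ⟨q, hq, rfl⟩ := ha
        rw [mem_filter] at hq
        rw [Finset.mem_Ico]
        exact ⟨hq.2.1, by have := hq.2.2; show q.val < (kv j).val + 1 + r; omega⟩
      have h := Finset.card_le_card hsub
      rw [Finset.card_map, Nat.card_Ico] at h
      omega
    calc ∑ j, ((univ : Finset (Fin N)).filter fun i => (kv j).val + 1 ≤ i.val ∧ i.val < (kv j).val + r).card
        ≤ ∑ j : Fin m, r := sum_le_sum fun j _ => hj j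
      _ = m * r := by rw [sum_const, smul_eq_mul, card_univ, Fintype.card_fin]
  refine lowDeg_mono hcard (mem_lowDeg_of_dependsOn3 T
    (fun x => thirdVal S (wTab (kAOf kv) sd (JOf r kv j₀) (fun j t => wval x (kv j).val t) g)) ?_)
  intro u v huv
  refine thirdVal_congr S fun q hq => ?_
  have hqw := mem_winU.1 (hS hq)
  have hJ := JOf_spec j₀ hqw
  set j := JOf r kv j₀ q
  have hqN := q.isLt
  have hw : wval u (kv j).val (q.val - (kv j).val) = wval v (kv j).val (q.val - (kv j).val) := by
    unfold wval
    rw [wcnt_local (kv j).val (q.val - (kv j).val) (by omega) u v (fun i h1 h2 => huv i (by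
      rw [hT, mem_biUnion]; exact ⟨j, mem_univ _, mem_filter.2 ⟨mem_univ _, h1, by omega⟩⟩))]
  simp only [wTab, kAOf]
  rw [hw]

/-- `V_{k⃗,g,ε}`: the excluded value read off the deviation pattern of `x^ε` in the window union. -/
def VU (P : Fin N → CubeFn (ZMod 3) N) (r : ℕ) (b : Fin F → ℕ) (kv : Fin m → Fin N) (sd : Fin m → Bool)
    (j₀ : Fin m) (g : Fin m → ZMod 3 × Bool) (ε : Fin F → Bool) : CubeFn (ZMod 3) N :=
  ∑ S ∈ (winU r kv).powerset, (fun x => patU P r kv S (orbF b ε x)) * hTabU r kv sd j₀ S g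

/-- AnchorDialDatumM helper `VU_mem` (decomp-qadv land package; see the module docstring). -/
theorem VU_mem {D : ℕ} {P : Fin N → CubeFn (ZMod 3) N} (hP : ∀ i, P i ∈ lowDeg (ZMod 3) N D) (r : ℕ)
    (b : Fin F → ℕ) (kv : Fin m → Fin N) (sd : Fin m → Bool) (j₀ : Fin m) (g : Fin m → ZMod 3 × Bool)
    (ε : Fin F → Bool) : VU P r b kv sd j₀ g ε ∈ lowDeg (ZMod 3) N (m * (r + 1) * ((D + D) + 2) + m * r) := by
  unfold VU
  refine Submodule.sum_mem _ fun S hS => ?_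
  rw [Finset.mem_powerset] at hS
  exact mul_mem_lowDeg_add (comp_orbF_mem (patU_mem hP r kv S) b ε) (hTabU_mem r kv sd j₀ S hS g)

/-- AnchorDialDatumM helper `VU_apply` (decomp-qadv land package; see the module docstring). -/
theorem VU_apply (P : Fin N → CubeFn (ZMod 3) N) (r : ℕ) (b : Fin F → ℕ) (kv : Fin m → Fin N)
    (sd : Fin m → Bool) (j₀ : Fin m) (g : Fin m → ZMod 3 × Bool) (ε : Fin F → Bool) (x : Fin N → Bool)
    (hdev : dev P (orbF b ε x) ⊆ winU r kv) :
    VU P r b kv sd j₀ g ε x =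
      thirdVal (dev P (orbF b ε x)) (wTab (kAOf kv) sd (JOf r kv j₀) (fun j t => wval x (kv j).val t) g) := by
  unfold VU
  rw [Finset.sum_apply, Finset.sum_eq_single (dev P (orbF b ε x))]
  · rw [Pi.mul_apply]
    show patU P r kv (dev P (orbF b ε x)) (orbF b ε x) * _ = _
    rw [patU_apply_self, one_mul]
    rfl
  · intro S hS hne
    rw [Finset.mem_powerset] at hS
    rw [Pi.mul_apply]
    show patU P r kv S (orbF b ε x) * _ = _
    rw [patU_apply_ne P r kv (orbF b ε x) S hS hdev hne, zero_mul]
  · intro h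
    exact absurd (Finset.mem_powerset.2 hdev) h

/-- the table component `T_{g,ε} = Σ_{k⃗} Π_j selP(A_j k_j) · V_{k⃗,g,ε}`. -/
def TU (P : Fin N → CubeFn (ZMod 3) N) (A : Fin m → Fin N → CubeFn (ZMod 3) N) (r : ℕ) (b : Fin F → ℕ)
    (j₀ : Fin m) (g : Fin m → ZMod 3 × Bool) (ε : Fin F → Bool) : CubeFn (ZMod 3) N :=
  ∑ kv : Fin m → Fin N, (∏ j, selP (A j (kv j))) * VU P r b kv (sdOf b kv) j₀ g ε

/-- AnchorDialDatumM helper `TU_mem` (decomp-qadv land package; see the module docstring). -/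
theorem TU_mem {D : ℕ} {P : Fin N → CubeFn (ZMod 3) N} (hP : ∀ i, P i ∈ lowDeg (ZMod 3) N D)
    {A : Fin m → Fin N → CubeFn (ZMod 3) N} (hA : ∀ j k, A j k ∈ lowDeg (ZMod 3) N D) (r : ℕ) (b : Fin F → ℕ)
    (j₀ : Fin m) (g : Fin m → ZMod 3 × Bool) (ε : Fin F → Bool) :
    TU P A r b j₀ g ε ∈ lowDeg (ZMod 3) N (m * (D + D) + (m * (r + 1) * ((D + D) + 2) + m * r)) := by
  unfold TU
  refine Submodule.sum_mem _ fun kv _ => ?_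
  refine mul_mem_lowDeg_add ?_ (VU_mem hP r b kv _ j₀ g ε)
  have h := prod_mem_lowDeg (univ : Finset (Fin m)) (fun j _ => selP_mem (hA j (kv j)))
  rwa [card_univ, Fintype.card_fin] at h

/-- AnchorDialDatumM helper `TU_apply` (decomp-qadv land package; see the module docstring). -/
theorem TU_apply (P : Fin N → CubeFn (ZMod 3) N) (A : Fin m → Fin N → CubeFn (ZMod 3) N) (r : ℕ)
    (b : Fin F → ℕ) (j₀ : Fin m) (g : Fin m → ZMod 3 × Bool) (ε : Fin F → Bool) (x : Fin N → Bool)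
    {kv₀ : Fin m → Fin N} (hk : ∀ j, anc (A j) x = {kv₀ j}) :
    TU P A r b j₀ g ε x = VU P r b kv₀ (sdOf b kv₀) j₀ g ε x := by
  unfold TU
  rw [Finset.sum_apply, Finset.sum_eq_single kv₀]
  · rw [Pi.mul_apply, Finset.prod_apply]
    have h1 : ∏ j, selP (A j (kv₀ j)) x = 1 :=
      Finset.prod_eq_one fun j _ => by rw [selP_anchor (hk j), if_pos rfl]
    rw [h1, one_mul]
  · intro kv _ hne
    obtain ⟨j, hj⟩ := Function.ne_iff.1 hne
    rw [Pi.mul_apply, Finset.prod_apply, Finset.prod_eq_zero (mem_univ j) (by rw [selP_anchor (hk j), if_neg hj]),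
      zero_mul]
  · intro h; exact absurd (mem_univ _) h

/-- the DATUM of `x`: the table family `(g, ε) ↦ T_{g,ε}(x)`. -/
def datM (P : Fin N → CubeFn (ZMod 3) N) (A : Fin m → Fin N → CubeFn (ZMod 3) N) (r : ℕ) (b : Fin F → ℕ)
    (j₀ : Fin m) (x : Fin N → Bool) : (Fin m → ZMod 3 × Bool) → (Fin F → Bool) → ZMod 3 :=
  fun g ε => TU P A r b j₀ g ε x

/-- the CLASS INDICATOR of a datum value. -/
def classM (P : Fin N → CubeFn (ZMod 3) N) (A : Fin m → Fin N → CubeFn (ZMod 3) N) (r : ℕ) (b : Fin F → ℕ)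
    (j₀ : Fin m) (δ : (Fin m → ZMod 3 × Bool) → (Fin F → Bool) → ZMod 3) : CubeFn (ZMod 3) N :=
  ∏ g : Fin m → ZMod 3 × Bool, ∏ ε : Fin F → Bool, indP (TU P A r b j₀ g ε) (δ g ε)

/-- AnchorDialDatumM helper `card_gauge` (decomp-qadv land package; see the module docstring). -/
theorem card_gauge (m : ℕ) : Fintype.card (Fin m → ZMod 3 × Bool) = 6 ^ m := by
  rw [Fintype.card_fun, Fintype.card_prod, ZMod.card, Fintype.card_bool, Fintype.card_fin]

/-- AnchorDialDatumM helper `classM_mem` (decomp-qadv land package; see the module docstring). -/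
theorem classM_mem {DT : ℕ} {P : Fin N → CubeFn (ZMod 3) N} {A : Fin m → Fin N → CubeFn (ZMod 3) N} {r : ℕ}
    {b : Fin F → ℕ} {j₀ : Fin m} (hT : ∀ g ε, TU P A r b j₀ g ε ∈ lowDeg (ZMod 3) N DT)
    (δ : (Fin m → ZMod 3 × Bool) → (Fin F → Bool) → ZMod 3) :
    classM P A r b j₀ δ ∈ lowDeg (ZMod 3) N (6 ^ m * (2 ^ F * (DT + DT))) := by
  unfold classM
  have h := prod_mem_lowDeg (univ : Finset (Fin m → ZMod 3 × Bool)) (D := 2 ^ F * (DT + DT))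
    (u := fun g => ∏ ε : Fin F → Bool, indP (TU P A r b j₀ g ε) (δ g ε)) (fun g _ => by
      have h' := prod_mem_lowDeg (univ : Finset (Fin F → Bool)) (fun ε _ => indP_mem (hT g ε) (δ g ε))
      rwa [card_univ, Fintype.card_fun, Fintype.card_bool, Fintype.card_fin] at h')
  rwa [card_univ, card_gauge] at h

/-- AnchorDialDatumM helper `classM_apply` (decomp-qadv land package; see the module docstring). -/
theorem classM_apply (P : Fin N → CubeFn (ZMod 3) N) (A : Fin m → Fin N → CubeFn (ZMod 3) N) (r : ℕ)
    (b : Fin F → ℕ) (j₀ : Fin m) (δ : (Fin m → ZMod 3 × Bool) → (Fin F → Bool) → ZMod 3) (x : Fin N → Bool) :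
    classM P A r b j₀ δ x = if datM P A r b j₀ x = δ then 1 else 0 := by
  unfold classM
  rw [Finset.prod_apply]
  simp only [Finset.prod_apply, indP_apply]
  by_cases h : datM P A r b j₀ x = δ
  · rw [if_pos h]
    refine Finset.prod_eq_one fun g _ => Finset.prod_eq_one fun ε _ => ?_
    rw [if_pos (by rw [← h]; rfl)]
  · rw [if_neg h]
    have hex : ∃ g ε, TU P A r b j₀ g ε x ≠ δ g ε := by
      by_contra hc
      push Not at hc
      exact h (funext fun g => funext fun ε => hc g ε)
    obtain ⟨g, ε, hne⟩ := hex
    exact Finset.prod_eq_zero (mem_univ g) (Finset.prod_eq_zero (mem_univ ε) (by rw [if_neg hne]))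

end DatumM

end Summit.QuantumAdvantage.QuantumAdvantage.Theorems.AnchorDial

end
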